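import Summits.AtomisticToContinuum.FouriersLaw.Theorems.BondHeatUncertaintySubdiffusiveBondHeatJunctionOneGoodScale

/-!
# Calibration of the buffered junction law: disproof seeds, the `C < 1` case, and the ballistic reading of the capped branch

Support file for stmt-AtomisticToContinuum-11071 (`BondHeatUncertainty.BoundedResponse`), decomposition cell `decomp-a2c`, lens-1 (grading),
gen 57 — file (10) (imports (9) `…JunctionOneGoodScale`).  After (9) the whole difficulty of the lens-1 line sits in the mechanism piece
`BufferedJunctionLaw` / `LocalityPassivityLaw` (file (5)); this file records, as checked theorems, what a disprover or a census must know
before attacking it.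

1. DISPROOF SEED (`exists_resistance_unbounded_of_not_bufferedJunctionLaw`): bounded escape resistance `1/E_N(T) ≤ M` (`N ≥ 2`) makes the
   buffered junction inequality hold TRIVIALLY at that temperature (`C = 2·max M 0`, any buffer, `N₂ = 2`; cf. file (5)
   `bufferedJunction_of_bounded`).  Hence ANY refutation of `BufferedJunctionLaw` must exhibit a parameter point `(ω₂, λ, β, γ, T)` at which
   `1/E_N(T)` is UNBOUNDED — i.e. must first prove a non-ballistic statement (`liminf_N E_N(T) = 0`, the content of stmt-9127 at that point)
   and then show that the sub-leading resistance corrections violate superadditivity-up-to-a-constant.  In particular the harmonic /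
   ballistic witnesses that refute every floor `F(s)`, `s > 0`, cannot touch the mechanism piece.
2. `C < 1` ⟹ OHMIC OUTRIGHT at that temperature (`escapeFloor_one_of_bufferedJunctionAt_lt_one`): `1/E_N ≥ 1 > C` for every `N ≥ 2`
   (`escapeDeficit_le_one`, `escapeDeficit_pos`), so every scale is a good scale (file (9) kernel) — generalises file (3)'s `C = 0`
   (`BufferedSeriesLaw`) case.
3. BALLISTIC READING of the capped branch of (9)'s dichotomy (`ballistic_of_resistanceCapped`): `1/E_N(T) ≤ C` on `N ≥ max N₂ 2` forces
   `C > 0` and, along EVERY steady-state family with response coefficients `D`, `D_N ≥ (N−1)γ/C` there (response identity, by name); and the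
   summit-facing dichotomy `ohmicAt_or_ballistic_of_localityPassivityLaw`: under `LocalityPassivityLaw`, at each temperature the chain is
   EITHER Ohmic (`E_N ≤ C₁/N` eventually) OR uniformly ballistic (`D_N ≥ (N−1)γ/C`, `N ≥ N₂'`, every family).

No new `def`; no `sorry`; standard axioms; nothing here closes an item.
-/

noncomputable section

open MeasureTheory Filter Topology Set

namespace Summit.AtomisticToContinuum.FouriersLaw.Theorems.SubdiffusiveBondHeat

namespace EscapeGrading

open Literature.MathematicalPhysics.KineticTheory.HeatConduction
open Summit.AtomisticToContinuum.FouriersLaw.Theses.BondHeatUncertainty (BoundedResponse NonBallistic)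

/-! ## 1. Disproof seed: bounded resistance makes the law trivial -/

/-- Bounded escape resistance (`1/E_N ≤ M` for `N ≥ 2`) gives the buffered junction inequality with defect `2M`, ANY buffer `L₀`, threshold `2`
(the right-hand side is `> 0` by `escapeDeficit_pos`). [folklore] -/
theorem bufferedJunctionAt_of_resistance_le {ω₂ lam β γ T M : ℝ} (hω : 0 < ω₂) (hl : 0 < lam) (hβ : 0 < β) (hγ : 0 < γ) (hT : 0 < T)
    (L₀ : ℕ) (hM : ∀ N : ℕ, 2 ≤ N → 1 / escapeDeficit ω₂ lam β γ T N ≤ M) :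
    ∀ u v : ℕ, 2 ≤ u → 2 ≤ v →
      1 / escapeDeficit ω₂ lam β γ T u + 1 / escapeDeficit ω₂ lam β γ T v - 2 * M
        ≤ 1 / escapeDeficit ω₂ lam β γ T (u + L₀ + v) := by
  intro u v hu hv
  have hu' := hM u hu
  have hv' := hM v hv
  have hw : 0 < 1 / escapeDeficit ω₂ lam β γ T (u + L₀ + v) :=
    one_div_pos.2 (JunctionDefectGrading.escapeDeficit_pos hω hl hβ hγ hT (by omega))
  linarith

/-- Bounded escape resistance at `T` ⟹ the per-temperature instance of `BufferedJunctionLaw` (defect `2·max M 0 ≥ 0`, buffer `0`, threshold `2`).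
[folklore] -/
theorem bufferedJunctionLawAt_of_resistance_le {ω₂ lam β γ T M : ℝ} (hω : 0 < ω₂) (hl : 0 < lam) (hβ : 0 < β) (hγ : 0 < γ) (hT : 0 < T)
    (hM : ∀ N : ℕ, 2 ≤ N → 1 / escapeDeficit ω₂ lam β γ T N ≤ M) :
    ∃ C : ℝ, 0 ≤ C ∧ ∃ L₀ N₂ : ℕ, ∀ u v : ℕ, N₂ ≤ u → N₂ ≤ v →
      1 / escapeDeficit ω₂ lam β γ T u + 1 / escapeDeficit ω₂ lam β γ T v - C
        ≤ 1 / escapeDeficit ω₂ lam β γ T (u + L₀ + v) := by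
  refine ⟨2 * max M 0, by positivity, 0, 2, fun u v hu hv => ?_⟩
  have h := bufferedJunctionAt_of_resistance_le hω hl hβ hγ hT 0 (fun N hN => le_trans (hM N hN) (le_max_left M 0)) u v hu hv
  simpa using h

/-- **Disproof seed, per temperature.**  If the buffered junction law FAILS at `(ω₂, λ, β, γ, T)` (for every defect, buffer and threshold),
then the escape resistance `1/E_N(T)` is unbounded: `∀ M ∃ N ≥ 2, M < 1/E_N(T)`. [folklore] -/
theorem resistance_unbounded_of_not_bufferedJunctionLawAt {ω₂ lam β γ T : ℝ} (hω : 0 < ω₂) (hl : 0 < lam) (hβ : 0 < β) (hγ : 0 < γ)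
    (hT : 0 < T)
    (hno : ¬ ∃ C : ℝ, 0 ≤ C ∧ ∃ L₀ N₂ : ℕ, ∀ u v : ℕ, N₂ ≤ u → N₂ ≤ v →
      1 / escapeDeficit ω₂ lam β γ T u + 1 / escapeDeficit ω₂ lam β γ T v - C
        ≤ 1 / escapeDeficit ω₂ lam β γ T (u + L₀ + v)) :
    ∀ M : ℝ, ∃ N : ℕ, 2 ≤ N ∧ M < 1 / escapeDeficit ω₂ lam β γ T N := by
  intro M
  by_contra hM
  push Not at hM
  exact hno (bufferedJunctionLawAt_of_resistance_le hω hl hβ hγ hT hM)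

/-- **DISPROOF SEED for the mechanism piece.**  `¬ BufferedJunctionLaw` ⟹ there is a parameter point `(ω₂, λ, β, γ, T)` (all positive) at
which the escape resistance is unbounded (`∀ M ∃ N ≥ 2, M < 1/E_N(T)`): any refutation of the law must first establish non-ballistic transport
somewhere — ballistic / harmonic-type witnesses cannot refute it. [folklore] -/
theorem exists_resistance_unbounded_of_not_bufferedJunctionLaw (h : ¬ JunctionDefectGrading.BufferedJunctionLaw) :
    ∃ ω₂ lam β γ T : ℝ, 0 < ω₂ ∧ 0 < lam ∧ 0 < β ∧ 0 < γ ∧ 0 < T ∧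
      ∀ M : ℝ, ∃ N : ℕ, 2 ≤ N ∧ M < 1 / escapeDeficit ω₂ lam β γ T N := by
  by_contra hall
  apply h
  intro ω₂ lam β γ hω hl hβ hγ T hT
  by_contra hno
  exact hall ⟨ω₂, lam, β, γ, T, hω, hl, hβ, hγ, hT, resistance_unbounded_of_not_bufferedJunctionLawAt hω hl hβ hγ hT hno⟩

/-- The same seed read through (9)'s currency: `¬ BufferedJunctionLaw` ⟹ at some parameter point `E_N(T) ≤ ε` for arbitrarily large `N`,
every `ε > 0` (the per-point content of `EscapeInfZero` ≡ stmt-9127). [folklore] -/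
theorem exists_escapeInfZeroAt_of_not_bufferedJunctionLaw (h : ¬ JunctionDefectGrading.BufferedJunctionLaw) :
    ∃ ω₂ lam β γ T : ℝ, 0 < ω₂ ∧ 0 < lam ∧ 0 < β ∧ 0 < γ ∧ 0 < T ∧
      ∀ ε : ℝ, 0 < ε → ∀ M : ℕ, ∃ N : ℕ, M ≤ N ∧ escapeDeficit ω₂ lam β γ T N ≤ ε := by
  obtain ⟨ω₂, lam, β, γ, T, hω, hl, hβ, hγ, hT, hunb⟩ := exists_resistance_unbounded_of_not_bufferedJunctionLaw h
  refine ⟨ω₂, lam, β, γ, T, hω, hl, hβ, hγ, hT, fun ε hε M => ?_⟩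
  -- the bound `max (1/ε) (Σ_{n<M} |1/E_n|)` is exceeded at some `N ≥ 2`; that `N` is `≥ M` and has `E_N ≤ ε`
  obtain ⟨N, hN2, hlt⟩ := hunb (max (1 / ε) (∑ n ∈ Finset.range M, |1 / escapeDeficit ω₂ lam β γ T n|))
  have hE : 0 < escapeDeficit ω₂ lam β γ T N := JunctionDefectGrading.escapeDeficit_pos hω hl hβ hγ hT hN2
  refine ⟨N, ?_, ?_⟩
  · by_contra hNM
    push Not at hNM
    have hle : |1 / escapeDeficit ω₂ lam β γ T N| ≤ ∑ n ∈ Finset.range M, |1 / escapeDeficit ω₂ lam β γ T n| :=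
      Finset.single_le_sum (f := fun n => |1 / escapeDeficit ω₂ lam β γ T n|) (fun n _ => abs_nonneg _)
        (Finset.mem_range.2 hNM)
    have h1 : 1 / escapeDeficit ω₂ lam β γ T N ≤ |1 / escapeDeficit ω₂ lam β γ T N| := le_abs_self _
    have h2 := lt_of_le_of_lt (le_max_right (1 / ε) _) hlt
    linarith
  · have h1 : 1 / ε < 1 / escapeDeficit ω₂ lam β γ T N := lt_of_le_of_lt (le_max_left _ _) hlt
    exact ((one_div_lt_one_div hε hE).1 h1).le

/-! ## 2. Defect below one contact unit: Ohmic outright -/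

/-- **`C < 1` ⟹ Ohmic at `T`.**  Since `1/E_N(T) ≥ 1` for every `N ≥ 2` (`escapeDeficit_le_one`, `escapeDeficit_pos`), under the buffered junction
inequality with defect `C < 1` EVERY scale `≥ max N₂ 2` is a good scale (`c = 1 − C`), and (9)'s kernel gives `E_N(T) ≤ C₁/N` eventually.
(`C = 0` is file (3)'s `BufferedSeriesLaw` case.) [kernel] -/
theorem escapeFloor_one_of_bufferedJunctionAt_lt_one {ω₂ lam β γ T : ℝ} (hω : 0 < ω₂) (hl : 0 < lam) (hβ : 0 < β) (hγ : 0 < γ)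
    (hT : 0 < T) {C : ℝ} {L₀ N₂ : ℕ} (hC1 : C < 1)
    (hJ : ∀ u v : ℕ, N₂ ≤ u → N₂ ≤ v →
      1 / escapeDeficit ω₂ lam β γ T u + 1 / escapeDeficit ω₂ lam β γ T v - C ≤ 1 / escapeDeficit ω₂ lam β γ T (u + L₀ + v)) :
    ∃ C₁ : ℝ, ∃ N₀ : ℕ, ∀ N : ℕ, N₀ ≤ N → escapeDeficit ω₂ lam β γ T N ≤ C₁ / (N : ℝ) := by
  have hE : 0 < escapeDeficit ω₂ lam β γ T (max N₂ 2) :=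
    JunctionDefectGrading.escapeDeficit_pos hω hl hβ hγ hT (le_max_right _ _)
  have h1 : 1 ≤ 1 / escapeDeficit ω₂ lam β γ T (max N₂ 2) :=
    one_le_one_div hE (escapeDeficit_le_one ω₂ lam β γ hω hl hβ hγ T hT (max N₂ 2))
  exact escapeFloor_one_of_bufferedJunctionAt_of_goodScale hω hl hβ hγ hT (c := 1 - C) (by linarith) hJ le_rfl (by linarith)

/-! ## 3. The capped branch is uniformly ballistic; the summit-facing dichotomy -/

/-- **Ballistic reading of the capped branch.**  If `1/E_N(T) ≤ C` for all `N ≥ max N₂ 2`, then `C > 0` and along EVERY steady-state family with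
response coefficients `D` (`D_N = (N−1)γE_N`, response identity + uniqueness of limits, by name): `D_N ≥ (N−1)γ/C` for `N ≥ max N₂ 2`. [folklore] -/
theorem ballistic_of_resistanceCapped {ω₂ lam β γ T C : ℝ} (hω : 0 < ω₂) (hl : 0 < lam) (hβ : 0 < β) (hγ : 0 < γ) (hT : 0 < T) {N₂ : ℕ}
    (hcap : ∀ N : ℕ, max N₂ 2 ≤ N → 1 / escapeDeficit ω₂ lam β γ T N ≤ C)
    (μ : (N : ℕ) → ℝ → ℝ → Measure (PhaseSpace N))
    (hμ : ∀ (N : ℕ) (T_L T_R : ℝ), 0 < T_L → 0 < T_R → (pinnedChain ω₂ lam β γ).IsSteadyState N T_L T_R (μ N T_L T_R))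
    (D : ℕ → ℝ)
    (hD : ∀ N : ℕ, Tendsto (fun δ : ℝ => (pinnedChain ω₂ lam β γ).totalCurrent (μ N (T + δ / 2) (T - δ / 2)) / δ)
      (𝓝[≠] 0) (𝓝 (D N))) :
    0 < C ∧ ∀ N : ℕ, max N₂ 2 ≤ N → ((N : ℝ) - 1) * γ / C ≤ D N := by
  have hpos : ∀ N : ℕ, 2 ≤ N → 0 < escapeDeficit ω₂ lam β γ T N := fun N hN =>
    JunctionDefectGrading.escapeDeficit_pos hω hl hβ hγ hT hN
  have hC : 0 < C := lt_of_lt_of_le (one_div_pos.2 (hpos _ (le_max_right N₂ 2))) (hcap _ le_rfl)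
  have huniq := bondHeatUncertainty_nessUnique_holds ω₂ lam β γ hω hl hβ hγ
  have hRI := boundaryEscapeDeficit_responseIdentity_holds ω₂ lam β γ hω hl hβ hγ huniq μ hμ T hT
  dsimp only at hRI
  refine ⟨hC, fun N hN => ?_⟩
  have hN2 : 2 ≤ N := le_trans (le_max_right _ _) hN
  have hDN : D N = ((N : ℝ) - 1) * γ * escapeDeficit ω₂ lam β γ T N := tendsto_nhds_unique (hD N) (hRI N (by omega)).2
  have hinv : 1 / C ≤ escapeDeficit ω₂ lam β γ T N := (one_div_le (hpos N hN2) hC).1 (hcap N hN)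
  have hN1 : (0 : ℝ) ≤ ((N : ℝ) - 1) * γ := by
    have h2 : (2 : ℝ) ≤ N := by exact_mod_cast hN2
    exact mul_nonneg (by linarith) hγ.le
  rw [hDN, div_eq_mul_one_div]
  exact mul_le_mul_of_nonneg_left hinv hN1

/-- **Dichotomy under the buffered junction law, response currency.**  At each temperature: EITHER `E_N(T) ≤ C₁/N` eventually (Ohmic), OR there
are `C > 0`, `N₂'` with `D_N ≥ (N−1)γ/C` for all `N ≥ N₂'` along EVERY steady-state family (uniformly ballistic). [kernel · frame] -/
theorem ohmicAt_or_ballistic_of_bufferedJunctionLaw (hB : JunctionDefectGrading.BufferedJunctionLaw) {ω₂ lam β γ : ℝ} (hω : 0 < ω₂)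
    (hl : 0 < lam) (hβ : 0 < β) (hγ : 0 < γ) {T : ℝ} (hT : 0 < T) :
    (∃ C₁ : ℝ, ∃ N₀ : ℕ, ∀ N : ℕ, N₀ ≤ N → escapeDeficit ω₂ lam β γ T N ≤ C₁ / (N : ℝ)) ∨
      (∃ C : ℝ, 0 < C ∧ ∃ N₂' : ℕ,
        ∀ μ : (N : ℕ) → ℝ → ℝ → Measure (PhaseSpace N),
          (∀ (N : ℕ) (T_L T_R : ℝ), 0 < T_L → 0 < T_R → (pinnedChain ω₂ lam β γ).IsSteadyState N T_L T_R (μ N T_L T_R)) →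
          ∀ D : ℕ → ℝ,
            (∀ N : ℕ, Tendsto (fun δ : ℝ => (pinnedChain ω₂ lam β γ).totalCurrent (μ N (T + δ / 2) (T - δ / 2)) / δ)
              (𝓝[≠] 0) (𝓝 (D N))) →
            ∀ N : ℕ, N₂' ≤ N → ((N : ℝ) - 1) * γ / C ≤ D N) := by
  obtain ⟨C, _, L₀, N₂, hJ⟩ := hB ω₂ lam β γ hω hl hβ hγ T hT
  rcases ohmicAt_or_resistanceCapped_of_bufferedJunctionAt hω hl hβ hγ hT hJ with h | hcap
  · exact Or.inl h
  · right
    have hC : 0 < C :=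
      lt_of_lt_of_le (one_div_pos.2 (JunctionDefectGrading.escapeDeficit_pos hω hl hβ hγ hT (le_max_right N₂ 2))) (hcap _ le_rfl)
    exact ⟨C, hC, max N₂ 2, fun μ hμ D hD N hN => (ballistic_of_resistanceCapped hω hl hβ hγ hT hcap μ hμ D hD).2 N hN⟩

/-- **Summit-facing dichotomy under `LocalityPassivityLaw`:** at each temperature the anharmonic pinned chain is EITHER Ohmic at the contact
(`E_N ≤ C₁/N` eventually) OR uniformly ballistic (`D_N ≥ (N−1)γ/C`, every steady-state family, `N ≥ N₂'`). [kernel · frame] -/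
theorem ohmicAt_or_ballistic_of_localityPassivityLaw (hL : JunctionDefectGrading.LocalityPassivityLaw) {ω₂ lam β γ : ℝ} (hω : 0 < ω₂)
    (hl : 0 < lam) (hβ : 0 < β) (hγ : 0 < γ) {T : ℝ} (hT : 0 < T) :
    (∃ C₁ : ℝ, ∃ N₀ : ℕ, ∀ N : ℕ, N₀ ≤ N → escapeDeficit ω₂ lam β γ T N ≤ C₁ / (N : ℝ)) ∨
      (∃ C : ℝ, 0 < C ∧ ∃ N₂' : ℕ,
        ∀ μ : (N : ℕ) → ℝ → ℝ → Measure (PhaseSpace N),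
          (∀ (N : ℕ) (T_L T_R : ℝ), 0 < T_L → 0 < T_R → (pinnedChain ω₂ lam β γ).IsSteadyState N T_L T_R (μ N T_L T_R)) →
          ∀ D : ℕ → ℝ,
            (∀ N : ℕ, Tendsto (fun δ : ℝ => (pinnedChain ω₂ lam β γ).totalCurrent (μ N (T + δ / 2) (T - δ / 2)) / δ)
              (𝓝[≠] 0) (𝓝 (D N))) →
            ∀ N : ℕ, N₂' ≤ N → ((N : ℝ) - 1) * γ / C ≤ D N) :=
  ohmicAt_or_ballistic_of_bufferedJunctionLaw (JunctionDefectGrading.bufferedJunctionLaw_of_localityPassivityLaw hL) hω hl hβ hγ hT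

end EscapeGrading

end Summit.AtomisticToContinuum.FouriersLaw.Theorems.SubdiffusiveBondHeat

end
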